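import Mathlib

/-!
# SoloBlind kernel #215 — Pincherle domination in a normed ring (the block continued fraction)

Matrix version of kernel #212 for the 2×2 block-Weyl recursion `R ↦ -(B + A R)⁻¹ C` of LEMMA R
(A8-CAP regime (I)): in any complete normed ring with `‖1‖ = 1`, if `B` is a unit with
`‖B⁻¹‖ · 2(‖A‖ + ‖C‖) ≤ 1` then for `‖R‖ ≤ 1` the element `B + A R` is a unit (Neumann series), the
step has norm at most `1/2`, and the step is a `1/8`-contraction on the unit ball.  These are the
certified truncation bounds for the backward recursion beyond the domination level.
-/

namespace Summit.AnomalousDissipation.AnomalousDissipation.Theorems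

variable {R : Type*} [NormedRing R] [NormOneClass R] [CompleteSpace R]

omit [NormOneClass R] [CompleteSpace R] in
/-- Under domination, `‖B⁻¹ (A R)‖ ≤ 1/2 < 1` on the unit ball. -/
theorem cfRing_small (B : Rˣ) (A C r : R) (hdom : ‖(↑B⁻¹ : R)‖ * (2 * (‖A‖ + ‖C‖)) ≤ 1)
    (hr : ‖r‖ ≤ 1) : ‖-((↑B⁻¹ : R) * (A * r))‖ < 1 := by
  rw [norm_neg]
  have h1 : ‖(↑B⁻¹ : R) * (A * r)‖ ≤ ‖(↑B⁻¹ : R)‖ * ‖A‖ := by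
    calc ‖(↑B⁻¹ : R) * (A * r)‖ ≤ ‖(↑B⁻¹ : R)‖ * ‖A * r‖ := norm_mul_le _ _
      _ ≤ ‖(↑B⁻¹ : R)‖ * (‖A‖ * ‖r‖) := by gcongr; exact norm_mul_le _ _
      _ ≤ ‖(↑B⁻¹ : R)‖ * (‖A‖ * 1) := by gcongr
      _ = ‖(↑B⁻¹ : R)‖ * ‖A‖ := by rw [mul_one]
  have h2 : ‖(↑B⁻¹ : R)‖ * ‖A‖ ≤ 1 / 2 := by
    nlinarith [norm_nonneg (↑B⁻¹ : R), norm_nonneg A, norm_nonneg C]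
  linarith

/-- The unit `B + A r = B (1 - (-(B⁻¹ A r)))`. -/
noncomputable def cfUnit (B : Rˣ) (A C r : R) (hdom : ‖(↑B⁻¹ : R)‖ * (2 * (‖A‖ + ‖C‖)) ≤ 1)
    (hr : ‖r‖ ≤ 1) : Rˣ :=
  B * Units.oneSub (-((↑B⁻¹ : R) * (A * r))) (cfRing_small B A C r hdom hr)

omit [NormOneClass R] in
/-- Its value is `B + A r`. -/
theorem cfUnit_val (B : Rˣ) (A C r : R) (hdom : ‖(↑B⁻¹ : R)‖ * (2 * (‖A‖ + ‖C‖)) ≤ 1)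
    (hr : ‖r‖ ≤ 1) : (↑(cfUnit B A C r hdom hr) : R) = ↑B + A * r := by
  unfold cfUnit
  rw [Units.val_mul, Units.val_oneSub, sub_neg_eq_add, mul_add, mul_one, ← mul_assoc,
    Units.mul_inv, one_mul]

/-- Norm of the inverse: `‖(B + A r)⁻¹‖ ≤ ‖B⁻¹‖ / (1 - ‖B⁻¹‖ ‖A‖)`. -/
theorem cfUnit_inv_norm (B : Rˣ) (A C r : R) (hdom : ‖(↑B⁻¹ : R)‖ * (2 * (‖A‖ + ‖C‖)) ≤ 1)
    (hr : ‖r‖ ≤ 1) :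
    ‖(↑(cfUnit B A C r hdom hr)⁻¹ : R)‖ ≤ ‖(↑B⁻¹ : R)‖ / (1 - ‖(↑B⁻¹ : R)‖ * ‖A‖) := by
  unfold cfUnit
  rw [mul_inv_rev, Units.val_mul]
  set β := ‖(↑B⁻¹ : R)‖ with hβ
  have hsmall := cfRing_small B A C r hdom hr
  have ht : ‖-((↑B⁻¹ : R) * (A * r))‖ ≤ β * ‖A‖ := by
    rw [norm_neg]
    calc ‖(↑B⁻¹ : R) * (A * r)‖ ≤ β * ‖A * r‖ := norm_mul_le _ _
      _ ≤ β * (‖A‖ * ‖r‖) := by gcongr; exact norm_mul_le _ _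
      _ ≤ β * (‖A‖ * 1) := by gcongr
      _ = β * ‖A‖ := by rw [mul_one]
  have hβA : β * ‖A‖ ≤ 1 / 2 := by
    nlinarith [norm_nonneg (↑B⁻¹ : R), norm_nonneg A, norm_nonneg C]
  have hN : ‖(↑(Units.oneSub (-((↑B⁻¹ : R) * (A * r))) hsmall)⁻¹ : R)‖ ≤
      (1 - ‖-((↑B⁻¹ : R) * (A * r))‖)⁻¹ := by
    -- Neumann bound (as in `SoloBlindGrushin.norm_inv_oneSub_le`)
    have := tsum_geometric_le_of_norm_lt_one (-((↑B⁻¹ : R) * (A * r))) hsmall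
    rw [norm_one, sub_self, zero_add] at this
    exact this
  calc ‖(↑(Units.oneSub (-((↑B⁻¹ : R) * (A * r))) hsmall)⁻¹ : R) * (↑B⁻¹ : R)‖
      ≤ ‖(↑(Units.oneSub (-((↑B⁻¹ : R) * (A * r))) hsmall)⁻¹ : R)‖ * β := norm_mul_le _ _
    _ ≤ (1 - ‖-((↑B⁻¹ : R) * (A * r))‖)⁻¹ * β := by gcongr
    _ ≤ (1 - β * ‖A‖)⁻¹ * β := by
        gcongr
        · linarith
    _ = β / (1 - β * ‖A‖) := by rw [div_eq_mul_inv, mul_comm]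

/-- The continued-fraction step in the ring: `-(B + A r)⁻¹ C`. -/
noncomputable def cfStepRing (B : Rˣ) (A C r : R)
    (hdom : ‖(↑B⁻¹ : R)‖ * (2 * (‖A‖ + ‖C‖)) ≤ 1) (hr : ‖r‖ ≤ 1) : R :=
  -((↑(cfUnit B A C r hdom hr)⁻¹ : R) * C)

/-- Invariance: the dominated step maps the unit ball into the ball of radius `1/2`. -/
theorem cfStepRing_norm_le_half (B : Rˣ) (A C r : R)
    (hdom : ‖(↑B⁻¹ : R)‖ * (2 * (‖A‖ + ‖C‖)) ≤ 1) (hr : ‖r‖ ≤ 1) :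
    ‖cfStepRing B A C r hdom hr‖ ≤ 1 / 2 := by
  unfold cfStepRing
  rw [norm_neg]
  set β := ‖(↑B⁻¹ : R)‖ with hβ
  have hinv := cfUnit_inv_norm B A C r hdom hr
  have hβA : β * ‖A‖ ≤ 1 / 2 := by
    nlinarith [norm_nonneg (↑B⁻¹ : R), norm_nonneg A, norm_nonneg C]
  have hpos : 0 < 1 - β * ‖A‖ := by linarith
  calc ‖(↑(cfUnit B A C r hdom hr)⁻¹ : R) * C‖ ≤ ‖(↑(cfUnit B A C r hdom hr)⁻¹ : R)‖ * ‖C‖ :=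
        norm_mul_le _ _
    _ ≤ β / (1 - β * ‖A‖) * ‖C‖ := by gcongr
    _ ≤ 1 / 2 := by
        rw [div_mul_eq_mul_div, div_le_iff₀ hpos]
        nlinarith [norm_nonneg (↑B⁻¹ : R), norm_nonneg A, norm_nonneg C]

/-- Contraction: on the unit ball the dominated step contracts by `1/8`. -/
theorem cfStepRing_contraction (B : Rˣ) (A C r r' : R)
    (hdom : ‖(↑B⁻¹ : R)‖ * (2 * (‖A‖ + ‖C‖)) ≤ 1) (hr : ‖r‖ ≤ 1) (hr' : ‖r'‖ ≤ 1) :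
    ‖cfStepRing B A C r hdom hr - cfStepRing B A C r' hdom hr'‖ ≤ (1 / 8) * ‖r - r'‖ := by
  unfold cfStepRing
  set X := cfUnit B A C r hdom hr with hX
  set Y := cfUnit B A C r' hdom hr' with hY
  set β := ‖(↑B⁻¹ : R)‖ with hβ
  -- -(X⁻¹ C) - -(Y⁻¹ C) = (Y⁻¹ - X⁻¹) C = X⁻¹ (X - Y) Y⁻¹ C and X - Y = A (r - r')
  have hXY : (↑X : R) - ↑Y = A * (r - r') := by
    rw [hX, hY, cfUnit_val, cfUnit_val, mul_sub]; abel
  have key : -((↑X⁻¹ : R) * C) - -((↑Y⁻¹ : R) * C) =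
      (↑X⁻¹ : R) * (A * (r - r')) * ↑Y⁻¹ * C := by
    rw [← hXY, mul_sub, sub_mul, sub_mul, Units.inv_mul, one_mul, mul_assoc (↑X⁻¹ : R),
      Units.mul_inv, mul_one]
    noncomm_ring
  rw [key]
  have hβA : β * ‖A‖ ≤ 1 / 2 := by
    nlinarith [norm_nonneg (↑B⁻¹ : R), norm_nonneg A, norm_nonneg C]
  have hpos : 0 < 1 - β * ‖A‖ := by linarith
  have hXi : ‖(↑X⁻¹ : R)‖ ≤ β / (1 - β * ‖A‖) := cfUnit_inv_norm B A C r hdom hr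
  have hYi : ‖(↑Y⁻¹ : R)‖ ≤ β / (1 - β * ‖A‖) := cfUnit_inv_norm B A C r' hdom hr'
  set q := β / (1 - β * ‖A‖) with hq
  have hq0 : 0 ≤ q := by positivity
  calc ‖(↑X⁻¹ : R) * (A * (r - r')) * ↑Y⁻¹ * C‖
      ≤ ‖(↑X⁻¹ : R)‖ * (‖A‖ * ‖r - r'‖) * ‖(↑Y⁻¹ : R)‖ * ‖C‖ := by
        calc _ ≤ ‖(↑X⁻¹ : R) * (A * (r - r')) * ↑Y⁻¹‖ * ‖C‖ := norm_mul_le _ _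
          _ ≤ ‖(↑X⁻¹ : R) * (A * (r - r'))‖ * ‖(↑Y⁻¹ : R)‖ * ‖C‖ := by
              gcongr; exact norm_mul_le _ _
          _ ≤ ‖(↑X⁻¹ : R)‖ * ‖A * (r - r')‖ * ‖(↑Y⁻¹ : R)‖ * ‖C‖ := by
              gcongr; exact norm_mul_le _ _
          _ ≤ ‖(↑X⁻¹ : R)‖ * (‖A‖ * ‖r - r'‖) * ‖(↑Y⁻¹ : R)‖ * ‖C‖ := by
              gcongr; exact norm_mul_le _ _
    _ ≤ q * (‖A‖ * ‖r - r'‖) * q * ‖C‖ := by gcongr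
    _ = (q * q * (‖A‖ * ‖C‖)) * ‖r - r'‖ := by ring
    _ ≤ (1 / 8) * ‖r - r'‖ := by
        gcongr
        -- q ≤ 1/(‖A‖ + 2‖C‖) and ‖A‖‖C‖ ≤ (‖A‖+2‖C‖)²/8
        by_cases hAC : ‖A‖ + ‖C‖ = 0
        · have hA : ‖A‖ = 0 := by linarith [norm_nonneg A, norm_nonneg C]
          rw [hA]; simp
        · have hACpos : 0 < ‖A‖ + ‖C‖ := lt_of_le_of_ne (by positivity) (Ne.symm hAC)
          set D := ‖A‖ + 2 * ‖C‖ with hD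
          have hDpos : 0 < D := by rw [hD]; linarith [norm_nonneg C]
          -- q = β/(1-β‖A‖) ≤ 1/D, i.e. q D ≤ 1, from 2β(‖A‖+‖C‖) ≤ 1
          have hq1 : q ≤ 1 / D := by
            rw [hq, div_le_div_iff₀ hpos hDpos]
            nlinarith [norm_nonneg A, norm_nonneg C, norm_nonneg (↑B⁻¹ : R)]
          have hqD : q * D ≤ 1 := by rwa [le_div_iff₀ hDpos] at hq1
          have h8 : 8 * (‖A‖ * ‖C‖) ≤ D ^ 2 := by
            rw [hD]; nlinarith [sq_nonneg (‖A‖ - 2 * ‖C‖)]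
          have hqD0 : 0 ≤ q * D := mul_nonneg hq0 hDpos.le
          calc q * q * (‖A‖ * ‖C‖) ≤ q * q * (D ^ 2 / 8) := by gcongr; linarith
            _ = (q * D) ^ 2 / 8 := by ring
            _ ≤ 1 / 8 := by
                have : (q * D) ^ 2 ≤ 1 := by nlinarith
                linarith

end Summit.AnomalousDissipation.AnomalousDissipation.Theorems
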